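import Mathlib
import HarnessLib

/-!
# The q³ piece of the CONJ-L edge shadow holds for ALL ladders: polarization across a 2-separation

Helper file for crux `stmt-CriticalPhenomena-4575` (new-inequality factory `prim-ineq-gen-1`, gen 18); memo
`run/shared/lean/prim/prim-ineq-gen-1/FINDING-25-ladder-q3-polarization.md`.

SETTING (memo §1).  Let `G ∖ {e,f} = G₁ ∪ G₂` with `V(G₁) ∩ V(G₂) = {u,w}`, `a ∈ G₁`, `v ∈ G₂`, `e = av`, `f = uw`.  The lowest
q-degree `[q³]` of the two-copy core `P_{e,f} = A·B_U − A_U·B` of the programme (FINDING-24; `(1−q)P = qΔ_G{e,f}`, so `[q³]P`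
is Wagner's spanning-connected Rayleigh difference `ΔS_G{e,f}`) is a UNIVERSAL biquadratic form `Bform` in the 3-terminal
'S-vectors' `(c,p,m,d,s)` of the two sides: `c = [xuw]`, `p = [xu|w]`, `m = [xw|u]`, `d = [x|uw]`, `s = [x|u|w]` are the
generating polynomials (in the side's edge weights) of the spanning subgraphs of the side with the indicated partition of its
terminals `x` (= `a` resp. `v`), `u`, `w` into components and no further component (memo §1, validated against brute force for
`K₄`, the prism and `L₃ + av`).  This file is the ALGEBRA of the proof:

* `polarization` — the identity
  `(p+m)(P+M)·B = (c+p+m)(C+P+M)(pM − mP)² + (P+M)²(C+P+M)·κ(c,p,m,d,s) + (p+m)²(c+p+m)·κ(C,P,M,D,S)`,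
  `κ = pm(c+p+m) + (p+m)²d − (p+m)cs` (`kappa`); so `B ≥ 0` as soon as `κ ≥ 0` on both sides (`Bform_nonneg`);
  `κ(G₁) ≥ 0` is itself the statement for the symmetric double `G₁ ⊕ G₁'` (THEOREM S2 of the memo).
* `colStep` — adding one ladder column to a side (a rung of weight `t` between the old terminals, rails `r₁, r₂` to the new
  terminals) acts linearly on `(c,p,m,d,s)`; `kappa_colStep` is the identity
  `(p+m)·κ(new) = (r₁r₂)²·[ cA²((p+m)cA + r₂p² + r₁m²) + (1+t)κ(old)((r₁+r₂)cA + r₁r₂(p+m)) ]`, `cA = c + t(c+p+m)`,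
  whence `κ` stays nonnegative (`kappa_colStep_nonneg`).
* `seg` — the S-vector of the ladder segment with `k+1` columns (apex joined to `u₁, w₁` by weights `y₁, y₂`, then `k` column
  steps); `kappa_seg_nonneg`, and the final `ladder_cubic_nonneg`: `0 ≤ Bform (seg …) (seg …)` for all positive weights —
  THEOREM L3 of the memo: for every `r ≥ 1` and every rung `f = uᵢwᵢ` of the ladder `L_r`, `[q³]P_{L_r+av; av, f} ≥ 0`, i.e. the
  lowest grade of CONJECTURE L's edge shadow (FINDING-22/23) holds for all ladders (the spokes and rails have no negative coefficient
  at all for `r ≤ 4`, FINDING-25 §3).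
What is NOT formalised: the identification of `Bform`/`seg` with the graph polynomials (finite type bookkeeping, memo §1,
scripts `lab/p21_twosep.py`, `lab/p28_validate_S2.py`).  (This work, 2026-08-21.)
-/

namespace Summit.CriticalPhenomena.PercolationContinuityZ3.Theorems

namespace TwoCopyLadderCubic

/-- The 3-terminal S-vector of one side of the 2-separation: `c=[xuw], p=[xu|w], m=[xw|u], d=[x|uw], s=[x|u|w]`. [this work] -/
structure SVec (R : Type*) where
  /-- `[xuw]`: all three terminals in one component -/
  c : R
  /-- `[xu|w]` -/
  p : R
  /-- `[xw|u]` -/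
  m : R
  /-- `[x|uw]` -/
  d : R
  /-- `[x|u|w]` -/
  s : R

variable {R : Type*} [CommRing R] [LinearOrder R] [IsStrictOrderedRing R]

/-- `κ = pm(c+p+m) + (p+m)²d − (p+m)cs`: the side form whose nonnegativity is the symmetric-double case. [this work] -/
def kappa (L : SVec R) : R := L.p * L.m * (L.c + L.p + L.m) + (L.p + L.m) ^ 2 * L.d - (L.p + L.m) * L.c * L.s

/-- The universal q³ form of a 2-separation with `e = av` across and `f = uw` (memo §1, 47 monomials). [this work] -/
def Bform (L K : SVec R) : R :=
  (K.p + K.m) * (K.c + K.p + K.m) * ((L.p + L.m) * L.d - L.c * L.s)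
    + (L.p + L.m) * (L.c + L.p + L.m) * ((K.p + K.m) * K.d - K.c * K.s)
    + (L.c + L.p + L.m) * (K.c + K.p + K.m) * (L.p * K.m + L.m * K.p)

omit [LinearOrder R] [IsStrictOrderedRing R] in
/-- THEOREM S2 (polarization identity). [this work] -/
theorem polarization (L K : SVec R) :
    (L.p + L.m) * (K.p + K.m) * Bform L K
      = (L.c + L.p + L.m) * (K.c + K.p + K.m) * (L.p * K.m - L.m * K.p) ^ 2
        + (K.p + K.m) ^ 2 * (K.c + K.p + K.m) * kappa L + (L.p + L.m) ^ 2 * (L.c + L.p + L.m) * kappa K := by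
  unfold Bform kappa; ring

/-- All five entries nonnegative. [this work] -/
structure SVec.Nonneg (L : SVec R) : Prop where
  /-- `0 ≤ c` -/
  hc : 0 ≤ L.c
  /-- `0 ≤ p` -/
  hp : 0 ≤ L.p
  /-- `0 ≤ m` -/
  hm : 0 ≤ L.m
  /-- `0 ≤ d` -/
  hd : 0 ≤ L.d
  /-- `0 ≤ s` -/
  hs : 0 ≤ L.s

/-- THEOREM S2: `B ≥ 0` whenever both sides have `κ ≥ 0` (and `p + m > 0`). [this work] -/
theorem Bform_nonneg (L K : SVec R) (hL : L.Nonneg) (hK : K.Nonneg) (hLp : 0 < L.p + L.m) (hKp : 0 < K.p + K.m)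
    (hkL : 0 ≤ kappa L) (hkK : 0 ≤ kappa K) : 0 ≤ Bform L K := by
  obtain ⟨hc, hp, hm, _, _⟩ := hL
  obtain ⟨hC, hP, hM, _, _⟩ := hK
  have hβ : 0 ≤ L.c + L.p + L.m := by linarith
  have hΒ : 0 ≤ K.c + K.p + K.m := by linarith
  have key := polarization L K
  have hrhs : 0 ≤ (L.p + L.m) * (K.p + K.m) * Bform L K := by
    rw [key]
    have h1 : 0 ≤ (L.c + L.p + L.m) * (K.c + K.p + K.m) * (L.p * K.m - L.m * K.p) ^ 2 :=
      mul_nonneg (mul_nonneg hβ hΒ) (sq_nonneg _)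
    have h2 : 0 ≤ (K.p + K.m) ^ 2 * (K.c + K.p + K.m) * kappa L := mul_nonneg (mul_nonneg (sq_nonneg _) hΒ) hkL
    have h3 : 0 ≤ (L.p + L.m) ^ 2 * (L.c + L.p + L.m) * kappa K := mul_nonneg (mul_nonneg (sq_nonneg _) hβ) hkK
    linarith
  have hpos : 0 < (L.p + L.m) * (K.p + K.m) := mul_pos hLp hKp
  exact (mul_nonneg_iff_of_pos_left hpos).mp hrhs

/-- Adding one ladder column to a side: rung of weight `t` between the old terminals `u,w`, rails of weights `r₁` (`u u'`) and
`r₂` (`w w'`) to the new terminals `u', w'` (memo §2: `cA = c + t(c+p+m)`, `dA = d + t(d+s)`; then `c' = r₁r₂cA`,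
`p' = r₁r₂p + r₁cA`, `m' = r₁r₂m + r₂cA`, `d' = r₁r₂dA`, `s' = r₁r₂s + r₁(m + dA) + r₂(p + dA) + cA`). [this work] -/
def colStep (t r₁ r₂ : R) (L : SVec R) : SVec R :=
  { c := r₁ * r₂ * (L.c + t * (L.c + L.p + L.m))
    p := r₁ * r₂ * L.p + r₁ * (L.c + t * (L.c + L.p + L.m))
    m := r₁ * r₂ * L.m + r₂ * (L.c + t * (L.c + L.p + L.m))
    d := r₁ * r₂ * (L.d + t * (L.d + L.s))
    s := r₁ * r₂ * L.s + r₁ * (L.m + (L.d + t * (L.d + L.s))) + r₂ * (L.p + (L.d + t * (L.d + L.s)))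
          + (L.c + t * (L.c + L.p + L.m)) }

omit [LinearOrder R] [IsStrictOrderedRing R] in
/-- The column-step identity for `κ` (memo §2). [this work] -/
theorem kappa_colStep (t r₁ r₂ : R) (L : SVec R) :
    (L.p + L.m) * kappa (colStep t r₁ r₂ L)
      = (r₁ * r₂) ^ 2 *
        ((L.c + t * (L.c + L.p + L.m)) ^ 2 *
            ((L.p + L.m) * (L.c + t * (L.c + L.p + L.m)) + r₂ * L.p ^ 2 + r₁ * L.m ^ 2)
          + (1 + t) * kappa L * ((r₁ + r₂) * (L.c + t * (L.c + L.p + L.m)) + r₁ * r₂ * (L.p + L.m))) := by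
  unfold kappa colStep; ring

/-- The column step preserves nonnegativity of the entries. [this work] -/
theorem colStep_nonneg {t r₁ r₂ : R} (ht : 0 ≤ t) (h1 : 0 ≤ r₁) (h2 : 0 ≤ r₂) {L : SVec R} (hL : L.Nonneg) :
    (colStep t r₁ r₂ L).Nonneg := by
  obtain ⟨hc, hp, hm, hd, hs⟩ := hL
  have hA : 0 ≤ L.c + t * (L.c + L.p + L.m) := by positivity
  have hD : 0 ≤ L.d + t * (L.d + L.s) := by positivity
  refine ⟨?_, ?_, ?_, ?_, ?_⟩ <;> simp only [colStep] <;> positivity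

/-- The column step keeps `p + m` positive (for positive rails). [this work] -/
theorem colStep_pm_pos {t r₁ r₂ : R} (ht : 0 ≤ t) (h1 : 0 < r₁) (h2 : 0 < r₂) {L : SVec R} (hL : L.Nonneg)
    (hpm : 0 < L.p + L.m) : 0 < (colStep t r₁ r₂ L).p + (colStep t r₁ r₂ L).m := by
  obtain ⟨hc, hp, hm, _, _⟩ := hL
  have hA : 0 ≤ L.c + t * (L.c + L.p + L.m) := by positivity
  simp only [colStep]
  have : 0 < r₁ * r₂ * (L.p + L.m) := mul_pos (mul_pos h1 h2) hpm
  nlinarith [mul_nonneg h1.le hA, mul_nonneg h2.le hA]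

/-- LEMMA K, inductive step: `κ ≥ 0` is preserved by a column step (positive rails, `p + m > 0`). [this work] -/
theorem kappa_colStep_nonneg {t r₁ r₂ : R} (ht : 0 ≤ t) (h1 : 0 < r₁) (h2 : 0 < r₂) {L : SVec R} (hL : L.Nonneg)
    (hpm : 0 < L.p + L.m) (hk : 0 ≤ kappa L) : 0 ≤ kappa (colStep t r₁ r₂ L) := by
  obtain ⟨hc, hp, hm, _, _⟩ := hL
  have hA : 0 ≤ L.c + t * (L.c + L.p + L.m) := by positivity
  have key := kappa_colStep t r₁ r₂ L
  have hrhs : 0 ≤ (L.p + L.m) * kappa (colStep t r₁ r₂ L) := by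
    rw [key]
    have h3 : 0 ≤ (L.p + L.m) * (L.c + t * (L.c + L.p + L.m)) + r₂ * L.p ^ 2 + r₁ * L.m ^ 2 := by positivity
    have h4 : 0 ≤ (r₁ + r₂) * (L.c + t * (L.c + L.p + L.m)) + r₁ * r₂ * (L.p + L.m) := by positivity
    have h5 : 0 ≤ (1 + t) * kappa L := mul_nonneg (by linarith) hk
    have h6 : 0 ≤ (L.c + t * (L.c + L.p + L.m)) ^ 2 *
        ((L.p + L.m) * (L.c + t * (L.c + L.p + L.m)) + r₂ * L.p ^ 2 + r₁ * L.m ^ 2) := mul_nonneg (sq_nonneg _) h3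
    have h7 : 0 ≤ (1 + t) * kappa L * ((r₁ + r₂) * (L.c + t * (L.c + L.p + L.m)) + r₁ * r₂ * (L.p + L.m)) :=
      mul_nonneg h5 h4
    exact mul_nonneg (sq_nonneg _) (by linarith)
  exact (mul_nonneg_iff_of_pos_left hpm).mp hrhs

/-- The one-column side: apex joined to `u₁` (weight `y₁`) and `w₁` (weight `y₂`): `c = y₁y₂, p = y₁, m = y₂, d = 0, s = 1`. [this work] -/
def base (y₁ y₂ : R) : SVec R := { c := y₁ * y₂, p := y₁, m := y₂, d := 0, s := 1 }

omit [LinearOrder R] [IsStrictOrderedRing R] in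
/-- `κ(base) = y₁²y₂²`. [this work] -/
theorem kappa_base (y₁ y₂ : R) : kappa (base y₁ y₂) = y₁ ^ 2 * y₂ ^ 2 := by
  unfold kappa base; ring

/-- A ladder side: the base column followed by a list of column steps `(t, r₁, r₂)` (rung between the current terminals, then the
two rails); for the pair `(av, uᵢwᵢ)` of `L_r + av` the left side uses columns `1..i` and the right side (apex `v`) columns `r..i`. [this work] -/
def seg (y₁ y₂ : R) : List (R × R × R) → SVec R
  | [] => base y₁ y₂
  | (t, r₁, r₂) :: cols => colStep t r₁ r₂ (seg y₁ y₂ cols)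

/-- Entries of a ladder side are nonnegative and `p + m > 0`. [this work] -/
theorem seg_nonneg_pm {y₁ y₂ : R} (hy₁ : 0 < y₁) (hy₂ : 0 < y₂) :
    ∀ cols : List (R × R × R), (∀ trr ∈ cols, 0 ≤ trr.1 ∧ 0 < trr.2.1 ∧ 0 < trr.2.2) →
      (seg y₁ y₂ cols).Nonneg ∧ 0 < (seg y₁ y₂ cols).p + (seg y₁ y₂ cols).m
  | [], _ => by
      refine ⟨⟨?_, hy₁.le, hy₂.le, le_rfl, zero_le_one⟩, ?_⟩
      · show 0 ≤ y₁ * y₂; positivity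
      · show 0 < y₁ + y₂; positivity
  | (t, r₁, r₂) :: cols, h => by
      have hcols : ∀ trr ∈ cols, 0 ≤ trr.1 ∧ 0 < trr.2.1 ∧ 0 < trr.2.2 :=
        fun trr htrr => h trr (List.mem_cons_of_mem _ htrr)
      obtain ⟨ht, h1, h2⟩ := h (t, r₁, r₂) List.mem_cons_self
      obtain ⟨hN, hpm⟩ := seg_nonneg_pm hy₁ hy₂ cols hcols
      exact ⟨colStep_nonneg ht h1.le h2.le hN, colStep_pm_pos ht h1 h2 hN hpm⟩

/-- LEMMA K for ladder sides: `κ(seg) ≥ 0`. [this work] -/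
theorem kappa_seg_nonneg {y₁ y₂ : R} (hy₁ : 0 < y₁) (hy₂ : 0 < y₂) :
    ∀ cols : List (R × R × R), (∀ trr ∈ cols, 0 ≤ trr.1 ∧ 0 < trr.2.1 ∧ 0 < trr.2.2) → 0 ≤ kappa (seg y₁ y₂ cols)
  | [], _ => by
      show 0 ≤ kappa (base y₁ y₂)
      rw [kappa_base]; positivity
  | (t, r₁, r₂) :: cols, h => by
      have hcols : ∀ trr ∈ cols, 0 ≤ trr.1 ∧ 0 < trr.2.1 ∧ 0 < trr.2.2 :=
        fun trr htrr => h trr (List.mem_cons_of_mem _ htrr)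
      obtain ⟨ht, h1, h2⟩ := h (t, r₁, r₂) List.mem_cons_self
      obtain ⟨hN, hpm⟩ := seg_nonneg_pm hy₁ hy₂ cols hcols
      exact kappa_colStep_nonneg ht h1 h2 hN hpm (kappa_seg_nonneg hy₁ hy₂ cols hcols)

/-- THEOREM L3 (algebraic form): the universal q³ form is nonnegative on any pair of ladder sides with positive weights — the
lowest q-degree of the CONJ-L edge shadow `[q³]P_{L_r+av; av, uᵢwᵢ} ≥ 0` for every ladder and every rung (memo §3). [this work] -/
theorem ladder_cubic_nonneg {y₁ y₂ z₁ z₂ : R} (hy₁ : 0 < y₁) (hy₂ : 0 < y₂) (hz₁ : 0 < z₁) (hz₂ : 0 < z₂)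
    (colsL colsR : List (R × R × R)) (hL : ∀ trr ∈ colsL, 0 ≤ trr.1 ∧ 0 < trr.2.1 ∧ 0 < trr.2.2)
    (hR : ∀ trr ∈ colsR, 0 ≤ trr.1 ∧ 0 < trr.2.1 ∧ 0 < trr.2.2) :
    0 ≤ Bform (seg y₁ y₂ colsL) (seg z₁ z₂ colsR) := by
  obtain ⟨hNL, hpmL⟩ := seg_nonneg_pm hy₁ hy₂ colsL hL
  obtain ⟨hNR, hpmR⟩ := seg_nonneg_pm hz₁ hz₂ colsR hR
  exact Bform_nonneg _ _ hNL hNR hpmL hpmR (kappa_seg_nonneg hy₁ hy₂ colsL hL) (kappa_seg_nonneg hz₁ hz₂ colsR hR)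


/-! ## Appendix (gen 18, same day): the SPOKE pairs `(av, au₁)` — THEOREM L3-spoke (FINDING-25 §3b)

For `e = av` and the spoke `f = au₁` the 2-cut `{u₁, w₁}` leaves on the apex side only the edge `aw₁` (weight `y₂`), so the
universal q³ form specialises to `Bspoke y₂ K = y₂²·σ(K) + 2y₂·K.c·K.p + y₂·K.c² + K.c²` with the side form
`σ = p(c+p+m+d) + md − cs` of the other side `K` (apex `v`, terminals `u₁, w₁`; `p = [v u₁ | w₁]`), which is a ladder side
followed by one `rungStep` (the rung `u₁w₁`).  `σ` propagates exactly: `σ(rungStep t K) = (1+t)σ(K)` and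
`σ(colStep t r₁ r₂ K) = (r₁r₂)²(1+t)σ(K) + r₁²·cA·((1+r₂)cA + 2r₂p)`, `cA = c + t(c+p+m)`; with `σ(base) = y₁²(y₂+1)` this gives
`σ ≥ 0` on all such sides and hence `[q³]P_{L_r+av; av, au₁} ≥ 0` for every `r` (in fact all these polynomials have nonnegative
coefficients in the edge weights, memo §3b).  The identification of `Bspoke` with `[q³]P` (validated as a polynomial identity for
`r ≤ 3`, lab/p44_spoke.py) is again not formalised. -/

/-- The spoke side form `σ = p(c+p+m+d) + md − cs`. [this work] -/
def sigma (L : SVec R) : R := L.p * (L.c + L.p + L.m + L.d) + L.m * L.d - L.c * L.s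

/-- Adding a rung of weight `t` between the current terminals (no new vertices): `c ↦ c + t(c+p+m)`, `d ↦ d + t(d+s)`. [this work] -/
def rungStep (t : R) (L : SVec R) : SVec R :=
  { c := L.c + t * (L.c + L.p + L.m), p := L.p, m := L.m, d := L.d + t * (L.d + L.s), s := L.s }

omit [LinearOrder R] [IsStrictOrderedRing R] in
/-- `σ` under a terminal rung: `σ ↦ (1+t)σ`. [this work] -/
theorem sigma_rungStep (t : R) (L : SVec R) : sigma (rungStep t L) = (1 + t) * sigma L := by
  unfold sigma rungStep; ring

omit [LinearOrder R] [IsStrictOrderedRing R] in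
/-- `σ` under a column step (exact identity with a manifestly nonnegative remainder). [this work] -/
theorem sigma_colStep (t r₁ r₂ : R) (L : SVec R) :
    sigma (colStep t r₁ r₂ L) = (r₁ * r₂) ^ 2 * (1 + t) * sigma L
      + r₁ ^ 2 * (L.c + t * (L.c + L.p + L.m)) * ((1 + r₂) * (L.c + t * (L.c + L.p + L.m)) + 2 * r₂ * L.p) := by
  unfold sigma colStep; ring

omit [LinearOrder R] [IsStrictOrderedRing R] in
/-- `σ(base) = y₁²(y₂ + 1)`. [this work] -/
theorem sigma_base (y₁ y₂ : R) : sigma (base y₁ y₂) = y₁ ^ 2 * (y₂ + 1) := by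
  unfold sigma base; ring

/-- `σ ≥ 0` is preserved by column steps with nonnegative weights. [this work] -/
theorem sigma_colStep_nonneg {t r₁ r₂ : R} (ht : 0 ≤ t) (h2 : 0 ≤ r₂) {L : SVec R} (hL : L.Nonneg)
    (hσ : 0 ≤ sigma L) : 0 ≤ sigma (colStep t r₁ r₂ L) := by
  obtain ⟨hc, hp, hm, _, _⟩ := hL
  have hA : 0 ≤ L.c + t * (L.c + L.p + L.m) := by positivity
  rw [sigma_colStep]
  have h1' : 0 ≤ (r₁ * r₂) ^ 2 * (1 + t) * sigma L := mul_nonneg (mul_nonneg (sq_nonneg _) (by linarith)) hσ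
  have h2' : 0 ≤ r₁ ^ 2 * (L.c + t * (L.c + L.p + L.m)) * ((1 + r₂) * (L.c + t * (L.c + L.p + L.m)) + 2 * r₂ * L.p) := by
    positivity
  linarith

/-- `σ(seg) ≥ 0` for every ladder side. [this work] -/
theorem sigma_seg_nonneg {y₁ y₂ : R} (hy₁ : 0 < y₁) (hy₂ : 0 < y₂) :
    ∀ cols : List (R × R × R), (∀ trr ∈ cols, 0 ≤ trr.1 ∧ 0 < trr.2.1 ∧ 0 < trr.2.2) → 0 ≤ sigma (seg y₁ y₂ cols)
  | [], _ => by
      show 0 ≤ sigma (base y₁ y₂)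
      rw [sigma_base]; positivity
  | (t, r₁, r₂) :: cols, h => by
      have hcols : ∀ trr ∈ cols, 0 ≤ trr.1 ∧ 0 < trr.2.1 ∧ 0 < trr.2.2 :=
        fun trr htrr => h trr (List.mem_cons_of_mem _ htrr)
      obtain ⟨ht, _, h2⟩ := h (t, r₁, r₂) List.mem_cons_self
      obtain ⟨hN, _⟩ := seg_nonneg_pm hy₁ hy₂ cols hcols
      exact sigma_colStep_nonneg ht h2.le hN (sigma_seg_nonneg hy₁ hy₂ cols hcols)

/-- The universal q³ form of the spoke pair `(av, au₁)`: apex side = the single edge `aw₁` of weight `y₂`, other side `K`. [this work] -/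
def Bspoke (y₂ : R) (K : SVec R) : R := y₂ ^ 2 * sigma K + 2 * y₂ * K.c * K.p + y₂ * K.c ^ 2 + K.c ^ 2

/-- THEOREM L3-spoke (algebraic form): `0 ≤ Bspoke y₂ (rungStep t (seg z₁ z₂ cols))` for nonnegative `y₂, t` and a ladder side with
positive weights — the q³ piece of `P_{L_r+av; av, au₁}` is nonnegative for every `r`. [this work] -/
theorem spoke_cubic_nonneg {y₂ t z₁ z₂ : R} (hy₂ : 0 ≤ y₂) (ht : 0 ≤ t) (hz₁ : 0 < z₁) (hz₂ : 0 < z₂)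
    (cols : List (R × R × R)) (h : ∀ trr ∈ cols, 0 ≤ trr.1 ∧ 0 < trr.2.1 ∧ 0 < trr.2.2) :
    0 ≤ Bspoke y₂ (rungStep t (seg z₁ z₂ cols)) := by
  obtain ⟨hN, _⟩ := seg_nonneg_pm hz₁ hz₂ cols h
  obtain ⟨hc, hp, _, _, _⟩ := hN
  have hσ : 0 ≤ sigma (rungStep t (seg z₁ z₂ cols)) := by
    rw [sigma_rungStep]; exact mul_nonneg (by linarith) (sigma_seg_nonneg hz₁ hz₂ cols h)
  have hc' : 0 ≤ (rungStep t (seg z₁ z₂ cols)).c := by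
    show 0 ≤ (seg z₁ z₂ cols).c + t * ((seg z₁ z₂ cols).c + (seg z₁ z₂ cols).p + (seg z₁ z₂ cols).m)
    obtain ⟨hc0, hp0, hm0, _, _⟩ := (seg_nonneg_pm hz₁ hz₂ cols h).1
    positivity
  have hp' : 0 ≤ (rungStep t (seg z₁ z₂ cols)).p := hp
  unfold Bspoke
  positivity


/-! ## Appendix 2 (gen 18): the RAIL pairs `(av, u_ju_{j+1})` — THEOREM L3-rail (FINDING-25 §3c)

For `f = u_ju_{j+1}` cut at `{u_{j+1}, w_{j+1}}`: on the apex side `u_{j+1}` is isolated once `f` is removed, the relevant left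
triple is `(a; u_j, w_{j+1})` and copy B merges `u_j ~ u_{j+1}`.  The universal q³ form collapses to
`Brail L K = K.c²·σ(L) + 2·L.c·L.p·K.c·K.p + L.c²·σ(K)` (13 monomials; validated against brute force for `r ≤ 3`, lab/p46_rail.py),
with the SAME side form `σ` on both sides: `L` = (ladder side from `a` with `j` columns) → `rungStep` (rung `u_jw_j`) → `pendW`
(the rail `w_jw_{j+1}` to the new terminal `w_{j+1}`), and `K` = (ladder side from `v`) → `rungStep` (rung `u_{j+1}w_{j+1}`).
Since `σ(pendW ρ L) = ρ²σ(L) + ρ·c·(c + 2p) + c²`, everything is nonnegative: `[q³]P_{L_r+av; av, u_ju_{j+1}} ≥ 0` for all `r, j`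
(with nonnegative coefficients).  Together with `ladder_cubic_nonneg` and `spoke_cubic_nonneg`: the whole q³ edge shadow of CONJ L
holds for every ladder. -/

/-- Pendant edge of weight `ρ` at the terminal `w` (new terminal `w'`; configurations in which the old `w` loses all terminals float away):
`c ↦ ρc`, `p ↦ ρp + c`, `m ↦ ρm`, `d ↦ ρd`, `s ↦ ρs + m + d`. [this work] -/
def pendW (ρ : R) (L : SVec R) : SVec R :=
  { c := ρ * L.c, p := ρ * L.p + L.c, m := ρ * L.m, d := ρ * L.d, s := ρ * L.s + L.m + L.d }

omit [LinearOrder R] [IsStrictOrderedRing R] in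
/-- `σ` under a pendant edge at `w`: `σ ↦ ρ²σ + ρc(c + 2p) + c²`. [this work] -/
theorem sigma_pendW (ρ : R) (L : SVec R) : sigma (pendW ρ L) = ρ ^ 2 * sigma L + ρ * L.c * (L.c + 2 * L.p) + L.c ^ 2 := by
  unfold sigma pendW; ring

/-- The universal q³ form of a rail pair. [this work] -/
def Brail (L K : SVec R) : R := K.c ^ 2 * sigma L + 2 * L.c * L.p * K.c * K.p + L.c ^ 2 * sigma K

/-- THEOREM L3-rail (algebraic form): `0 ≤ Brail L K` for `L = pendW ρ (rungStep t (seg y₁ y₂ cols))` and `K = rungStep t' (seg z₁ z₂ cols')`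
with nonnegative `ρ, t, t'` and positive side weights — the q³ piece of `P_{L_r+av; av, u_ju_{j+1}}` is nonnegative for every `r` and `j`.
[this work] -/
theorem rail_cubic_nonneg {ρ t t' y₁ y₂ z₁ z₂ : R} (hρ : 0 ≤ ρ) (ht : 0 ≤ t) (ht' : 0 ≤ t') (hy₁ : 0 < y₁) (hy₂ : 0 < y₂)
    (hz₁ : 0 < z₁) (hz₂ : 0 < z₂) (cols cols' : List (R × R × R))
    (h : ∀ trr ∈ cols, 0 ≤ trr.1 ∧ 0 < trr.2.1 ∧ 0 < trr.2.2) (h' : ∀ trr ∈ cols', 0 ≤ trr.1 ∧ 0 < trr.2.1 ∧ 0 < trr.2.2) :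
    0 ≤ Brail (pendW ρ (rungStep t (seg y₁ y₂ cols))) (rungStep t' (seg z₁ z₂ cols')) := by
  obtain ⟨⟨hc, hp, hm, _, _⟩, _⟩ := seg_nonneg_pm hy₁ hy₂ cols h
  obtain ⟨⟨hC, hP, hM, _, _⟩, _⟩ := seg_nonneg_pm hz₁ hz₂ cols' h'
  have hσL0 : 0 ≤ sigma (rungStep t (seg y₁ y₂ cols)) := by
    rw [sigma_rungStep]; exact mul_nonneg (by linarith) (sigma_seg_nonneg hy₁ hy₂ cols h)
  have hcA : 0 ≤ (rungStep t (seg y₁ y₂ cols)).c := by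
    show 0 ≤ (seg y₁ y₂ cols).c + t * ((seg y₁ y₂ cols).c + (seg y₁ y₂ cols).p + (seg y₁ y₂ cols).m); positivity
  have hpA : 0 ≤ (rungStep t (seg y₁ y₂ cols)).p := hp
  have hσL : 0 ≤ sigma (pendW ρ (rungStep t (seg y₁ y₂ cols))) := by
    rw [sigma_pendW]
    have h1 : 0 ≤ ρ ^ 2 * sigma (rungStep t (seg y₁ y₂ cols)) := mul_nonneg (sq_nonneg _) hσL0
    have h2 : 0 ≤ ρ * (rungStep t (seg y₁ y₂ cols)).c * ((rungStep t (seg y₁ y₂ cols)).c + 2 * (rungStep t (seg y₁ y₂ cols)).p) := by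
      positivity
    have h3 : 0 ≤ (rungStep t (seg y₁ y₂ cols)).c ^ 2 := sq_nonneg _
    linarith
  have hσK : 0 ≤ sigma (rungStep t' (seg z₁ z₂ cols')) := by
    rw [sigma_rungStep]; exact mul_nonneg (by linarith) (sigma_seg_nonneg hz₁ hz₂ cols' h')
  have hcK : 0 ≤ (rungStep t' (seg z₁ z₂ cols')).c := by
    show 0 ≤ (seg z₁ z₂ cols').c + t' * ((seg z₁ z₂ cols').c + (seg z₁ z₂ cols').p + (seg z₁ z₂ cols').m); positivity
  have hpK : 0 ≤ (rungStep t' (seg z₁ z₂ cols')).p := hP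
  have hcL : 0 ≤ (pendW ρ (rungStep t (seg y₁ y₂ cols))).c := by
    show 0 ≤ ρ * (rungStep t (seg y₁ y₂ cols)).c; positivity
  have hpL : 0 ≤ (pendW ρ (rungStep t (seg y₁ y₂ cols))).p := by
    show 0 ≤ ρ * (rungStep t (seg y₁ y₂ cols)).p + (rungStep t (seg y₁ y₂ cols)).c; positivity
  unfold Brail
  have e1 : 0 ≤ (rungStep t' (seg z₁ z₂ cols')).c ^ 2 * sigma (pendW ρ (rungStep t (seg y₁ y₂ cols))) := mul_nonneg (sq_nonneg _) hσL
  have e2 : 0 ≤ 2 * (pendW ρ (rungStep t (seg y₁ y₂ cols))).c * (pendW ρ (rungStep t (seg y₁ y₂ cols))).p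
      * (rungStep t' (seg z₁ z₂ cols')).c * (rungStep t' (seg z₁ z₂ cols')).p := by positivity
  have e3 : 0 ≤ (pendW ρ (rungStep t (seg y₁ y₂ cols))).c ^ 2 * sigma (rungStep t' (seg z₁ z₂ cols')) := mul_nonneg (sq_nonneg _) hσK
  linarith

end TwoCopyLadderCubic

end Summit.CriticalPhenomena.PercolationContinuityZ3.Theorems
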